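import Summits.ResolutionOfSingularities.ResolutionOfSingularities.Theorems.EquisingularLiftEquisingularLiftNatEBetaVertex
import Literature.AlgebraicGeometry.Resolution.NodalPowRingSingularLocus
import Mathlib.Algebra.Polynomial.Monic
import Mathlib.RingTheory.Ideal.Quotient.Basic
import HarnessLib

/-!
# [OURS · L1 W4.5(b)] T-EBETA-CHARTS, II: exit (E-β) at a CUSP — the rows `N = 2 ✓` and `N = 3 ✗`

Helper for the research stub `stub_elnat_three_isolated_nonabs` of the crux `EquisingularLiftNatThree`
(stmt-ResolutionOfSingularities-20148, child of `EquisingularLiftNat` stmt-20038; route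
`EquisingularLift`, chain w45b, CHAIN v7.2/7.3 §3 row **T-EBETA-CHARTS** named to stub-4;
res-L1-w45b-lead-2 LEAD-MEMO-2 §5 «For a CUSP (m = 2, ḡ = y² − x³): N = 3 gives D₄ = {y² = x³ − ϖ³u},
Bl_q D₄ has 3 A₁ points ✗; N = 2 gives A₂ = {y² − x³ + cϖ²}, Bl_q A₂ regular ✓»). NOT a statement of
any manuscript; AI-written kernel lemma of the cell `res-hironaka` (weaker than expert review).

Setting of part I (`…NatEBetaVertex.lean`): `O` a domain, `ϖ ≠ 0` with `(ϖ)` maximal (a DVR and its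
uniformizer), the `ϖ`-chart `A′ = O[T₁, T₂]` (`x = ϖT₁`, `y = ϖT₂`) of the blow-up of `𝔸²_O` at
`𝔪 = (ϖ, x, y)`, exceptional divisor `V(ϖ)`.

* **Row `N = 2` ✓**: `G = y² − x³ + cϖ²` (`c ∈ Oˣ`), `G(ϖT) = ϖ²·g₂`, `g₂ = T₂² − ϖT₁³ + c`
  (`cusp2_chart_identity`); for `2 ∈ Oˣ` the derivative `∂/∂T₂ g₂ = 2T₂` lies in NO prime `Q ∋ ϖ, g₂`
  (else `c ∈ Q`), so **`cusp2_regular_along_E`**: `A′_Q/(g₂)` is regular at every prime of the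
  exceptional divisor — «Bl_q A₂ regular ✓».
* **Row `N = 3` ✗**: `G = y² − x³ + uϖ³`, `G(ϖT) = ϖ²·g₃`, `g₃ = T₂² + ϖ(u − T₁³)`
  (`cusp3_chart_identity`); at the primes `Q = (ϖ, T₂, 𝔫)` with `𝔫 ∋ T₁³ − ū` a maximal ideal of
  `k[T₁]` (`k = O/ϖ`; these exist: `T₁³ − ū` is monic of degree 3) one has `g₃ ∈ Q²`, hence
  **`cusp3_not_regular`**: `A′_Q/(g₃)` is NOT a regular local ring (Matsumura 14.2, the tree's
  `not_isRegularLocalRing_quotient_span_singleton_of_mem_sq'`) — «3 A₁ points ✗» (over `k̄` the three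
  primes are `T₁ = ∛ū`; the memo's chart `ϖ = xϖ₁` sees them as `ϖ₁³u = 1`).

NOT here (as in part I): the off-vertex charts, the blowup-algebra iso `A[𝔪/ϖ] ≅ O[T₁,T₂]`, E1 and
flatness of the centre, anything scheme-level; the `A₄`-contact row `g² + t⁵` of LEAD-MEMO-2 §5–§6.

References: H. Matsumura, *Commutative Ring Theory*, Thm. 14.2; The Stacks Project, Tag 07PF — through
the cited tree files.
-/

set_option linter.dupNamespace false -- mandated namespace `Summit.<Summit>.<Problem>` of this single-conjunct summit

noncomputable section

open MvPolynomial IsLocalRing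
open Literature.AlgebraicGeometry.Resolution
open Summit.ResolutionOfSingularities.ResolutionOfSingularities.Theorems.EquisingularLift.SpecimenQuartic

namespace Summit.ResolutionOfSingularities.ResolutionOfSingularities.Theorems.EquisingularLift.EBeta

universe u

variable {O : Type u} [CommRing O]

/-! ## Row `N = 2`: `G = y² − x³ + cϖ²`, `g₂ = T₂² − ϖT₁³ + c` -/

/-- **Chart identity, cusp `N = 2`.** `y² − x³ + cϖ² = ϖ²·(T₂² − ϖT₁³ + c)` under `x = ϖT₁`, `y = ϖT₂`.
[folklore] -/
theorem cusp2_chart_identity (ϖ c : O) :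
    aeval ![C ϖ * X 0, C ϖ * X 1] (X 1 ^ 2 - X 0 ^ 3 + C (c * ϖ ^ 2) : MvPolynomial (Fin 2) O) =
      C ϖ ^ 2 * (X 1 ^ 2 - C ϖ * X 0 ^ 3 + C c) := by
  simp only [map_add, map_sub, map_mul, map_pow, aeval_X, Matrix.cons_val_zero, Matrix.cons_val_one,
    MvPolynomial.algebraMap_eq, aeval_C]
  ring

/-- `∂/∂T₂ (T₂² − ϖT₁³ + c) = 2T₂`. [folklore] -/
theorem pderiv_one_cusp2 (ϖ c : O) :
    (pderiv 1 : Derivation O (MvPolynomial (Fin 2) O) _) (X 1 ^ 2 - C ϖ * X 0 ^ 3 + C c) = 2 * X 1 := by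
  simp [Derivation.leibniz_pow]

/-- `2 ∈ Oˣ` gives `2 ∈ O[T₁,T₂]ˣ`. [folklore] -/
theorem isUnit_two_mvPolynomial (h2 : IsUnit (2 : O)) : IsUnit (2 : MvPolynomial (Fin 2) O) := by
  have h := h2.map (C : O →+* MvPolynomial (Fin 2) O)
  rwa [map_ofNat] at h

/-- **Cusp `N = 2`: the derivative `2T₂` lies in no prime `Q ∋ ϖ, g₂`** (`2, c ∈ Oˣ`): otherwise
`T₂ ∈ Q` and `c = g₂ − T₂² + ϖT₁³ ∈ Q`. [OURS · (E-β), LEAD-MEMO-2 §5] -/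
theorem cusp2_pderiv_not_mem {ϖ c : O} (h2 : IsUnit (2 : O)) (hc : IsUnit c)
    (Q : Ideal (MvPolynomial (Fin 2) O)) [hQ : Q.IsPrime] (hϖQ : C ϖ ∈ Q)
    (hgQ : (X 1 ^ 2 - C ϖ * X 0 ^ 3 + C c : MvPolynomial (Fin 2) O) ∈ Q) :
    (pderiv 1 : Derivation O (MvPolynomial (Fin 2) O) _) (X 1 ^ 2 - C ϖ * X 0 ^ 3 + C c) ∉ Q := by
  rw [pderiv_one_cusp2]
  intro h
  have hX1 : (X 1 : MvPolynomial (Fin 2) O) ∈ Q := mem_of_two_mul_mem hQ (isUnit_two_mvPolynomial h2) h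
  have hcQ : (C c : MvPolynomial (Fin 2) O) ∈ Q := by
    have e : (C c : MvPolynomial (Fin 2) O) =
        (X 1 ^ 2 - C ϖ * X 0 ^ 3 + C c) - X 1 * X 1 + C ϖ * X 0 ^ 3 := by ring
    rw [e]
    exact Q.add_mem (Q.sub_mem hgQ (Q.mul_mem_left _ hX1)) (Q.mul_mem_right _ hϖQ)
  exact hQ.ne_top (Ideal.eq_top_of_isUnit_mem _ hcQ (hc.map C))

/-- **Cusp `N = 2`, `ϖ`-chart: `Bl_q D` is regular along the exceptional divisor** (`O` regular — a
DVR —, `2, c ∈ Oˣ`): at every prime `Q ∋ ϖ, g₂` of `O[T₁,T₂]` the local ring `A′_Q/(g₂)` is regular.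
«N = 2 gives A₂ = {y² − x³ + cϖ²}, Bl_q A₂ regular ✓» (LEAD-MEMO-2 §5). [OURS · (E-β)] -/
theorem cusp2_regular_along_E [IsRegularRing O] {ϖ c : O} (h2 : IsUnit (2 : O)) (hc : IsUnit c)
    (Q : Ideal (MvPolynomial (Fin 2) O)) [Q.IsPrime] (hϖQ : C ϖ ∈ Q)
    (hgQ : (X 1 ^ 2 - C ϖ * X 0 ^ 3 + C c : MvPolynomial (Fin 2) O) ∈ Q) :
    IsRegularLocalRing (Localization.AtPrime Q ⧸
      Ideal.span {algebraMap (MvPolynomial (Fin 2) O) (Localization.AtPrime Q)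
        (X 1 ^ 2 - C ϖ * X 0 ^ 3 + C c)}) :=
  isRegularLocalRing_quotient_of_derivation _ (pderiv 1) Q hgQ (cusp2_pderiv_not_mem h2 hc Q hϖQ hgQ)

/-! ## Row `N = 3`: `G = y² − x³ + uϖ³`, `g₃ = T₂² + ϖ(u − T₁³)` — NOT regular -/

/-- **Chart identity, cusp `N = 3`.** `y² − x³ + uϖ³ = ϖ²·(T₂² + ϖ(u − T₁³))` under `x = ϖT₁`,
`y = ϖT₂`. [folklore] -/
theorem cusp3_chart_identity (ϖ u : O) :
    aeval ![C ϖ * X 0, C ϖ * X 1] (X 1 ^ 2 - X 0 ^ 3 + C (u * ϖ ^ 3) : MvPolynomial (Fin 2) O) =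
      C ϖ ^ 2 * (X 1 ^ 2 + C ϖ * (C u - X 0 ^ 3)) := by
  simp only [map_add, map_sub, map_mul, map_pow, aeval_X, Matrix.cons_val_zero, Matrix.cons_val_one,
    MvPolynomial.algebraMap_eq, aeval_C]
  ring

/-- **Cusp `N = 3`: the singular primes.** Over a domain `O` with `(ϖ)` maximal there is a prime
`Q ∋ ϖ, T₂, u − T₁³` of `O[T₁,T₂]` (pull back a maximal ideal of `k[T]`, `k = O/ϖ`, containing the
non-unit `T³ − ū`), and for every such prime `g₃ = T₂·T₂ + ϖ·(u − T₁³) ∈ Q²`. [OURS · (E-β) negative row] -/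
theorem cusp3_exists_prime_mem_sq [IsDomain O] {ϖ : O} (hmax : (Ideal.span {ϖ}).IsMaximal) (u : O) :
    ∃ Q : Ideal (MvPolynomial (Fin 2) O), Q.IsPrime ∧ C ϖ ∈ Q ∧ (X 1 : MvPolynomial (Fin 2) O) ∈ Q ∧
      (X 1 ^ 2 + C ϖ * (C u - X 0 ^ 3) : MvPolynomial (Fin 2) O) ∈ Q ^ 2 := by
  haveI : (Ideal.span {ϖ}).IsMaximal := hmax
  letI : Field (O ⧸ Ideal.span {ϖ}) := Ideal.Quotient.field (Ideal.span {ϖ})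
  -- `k[T]` and the non-unit `T³ − ū`
  set f₀ : Polynomial (O ⧸ Ideal.span {ϖ}) :=
    Polynomial.X ^ 3 - Polynomial.C (Ideal.Quotient.mk (Ideal.span {ϖ}) u) with hf₀
  have hf₀u : ¬ IsUnit f₀ := by
    intro h
    have hm : f₀.Monic := Polynomial.monic_X_pow_sub_C _ (by norm_num)
    have h1 := hm.eq_one_of_isUnit h
    have hdeg := congrArg Polynomial.natDegree h1
    rw [hf₀, Polynomial.natDegree_X_pow_sub_C, Polynomial.natDegree_one] at hdeg
    exact absurd hdeg (by norm_num)
  obtain ⟨𝔫, h𝔫max, hf₀𝔫⟩ := Ideal.exists_le_maximal (Ideal.span {f₀})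
    (fun h => hf₀u (Ideal.span_singleton_eq_top.mp h))
  have hf₀𝔫' : f₀ ∈ 𝔫 := hf₀𝔫 (Ideal.mem_span_singleton_self f₀)
  -- `ψ : O[T₁,T₂] → k[T]`, `T₁ ↦ T`, `T₂ ↦ 0`
  set ψ : MvPolynomial (Fin 2) O →+* Polynomial (O ⧸ Ideal.span {ϖ}) :=
    MvPolynomial.eval₂Hom (Polynomial.C.comp (Ideal.Quotient.mk (Ideal.span {ϖ}))) ![Polynomial.X, 0] with hψ
  refine ⟨𝔫.comap ψ, Ideal.comap_isPrime ψ 𝔫, ?_, ?_, ?_⟩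
  · rw [Ideal.mem_comap, hψ, MvPolynomial.coe_eval₂Hom, MvPolynomial.eval₂_C, RingHom.comp_apply,
      Ideal.Quotient.eq_zero_iff_mem.mpr (Ideal.mem_span_singleton_self ϖ), map_zero]
    exact 𝔫.zero_mem
  · rw [Ideal.mem_comap, hψ, MvPolynomial.coe_eval₂Hom, MvPolynomial.eval₂_X]
    exact 𝔫.zero_mem
  · have hX1 : (X 1 : MvPolynomial (Fin 2) O) ∈ 𝔫.comap ψ := by
      rw [Ideal.mem_comap, hψ, MvPolynomial.coe_eval₂Hom, MvPolynomial.eval₂_X]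
      exact 𝔫.zero_mem
    have hϖ' : (C ϖ : MvPolynomial (Fin 2) O) ∈ 𝔫.comap ψ := by
      rw [Ideal.mem_comap, hψ, MvPolynomial.coe_eval₂Hom, MvPolynomial.eval₂_C, RingHom.comp_apply,
        Ideal.Quotient.eq_zero_iff_mem.mpr (Ideal.mem_span_singleton_self ϖ), map_zero]
      exact 𝔫.zero_mem
    have hcube : (C u - X 0 ^ 3 : MvPolynomial (Fin 2) O) ∈ 𝔫.comap ψ := by
      rw [Ideal.mem_comap]
      have e : ψ (C u - X 0 ^ 3) = -f₀ := by
        rw [hψ, map_sub, map_pow, MvPolynomial.coe_eval₂Hom, MvPolynomial.eval₂_C, MvPolynomial.eval₂_X,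
          RingHom.comp_apply, hf₀]
        simp only [Matrix.cons_val_zero, neg_sub]
      rw [e]
      exact 𝔫.neg_mem hf₀𝔫'
    rw [pow_two]
    exact Ideal.add_mem _ (by rw [pow_two]; exact Ideal.mul_mem_mul hX1 hX1) (Ideal.mul_mem_mul hϖ' hcube)

/-- `g₃ ≠ 0` (its `T₂²`-coefficient is `1`). [folklore] -/
theorem cusp3_ne_zero [Nontrivial O] (ϖ u : O) :
    (X 1 ^ 2 + C ϖ * (C u - X 0 ^ 3) : MvPolynomial (Fin 2) O) ≠ 0 := by
  intro h
  have hc := congrArg (MvPolynomial.coeff (Finsupp.single (1 : Fin 2) 2)) h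
  classical
  rw [coeff_add, coeff_X_pow, if_pos rfl, mul_sub, coeff_sub, ← map_mul, coeff_C, if_neg, coeff_C_mul,
    coeff_X_pow, if_neg, coeff_zero] at hc
  · simp at hc
  · intro h0
    have := congrArg (fun e : Fin 2 →₀ ℕ => e 1) h0
    simp at this
  · intro h0
    have := congrArg (fun e : Fin 2 →₀ ℕ => e 1) h0
    simp at this

/-- **Cusp `N = 3`, `ϖ`-chart: `Bl_q D₄` is NOT regular** — «N = 3 gives D₄ = {y² = x³ − ϖ³u},
Bl_q D₄ has 3 A₁ points ✗» (LEAD-MEMO-2 §5): over a Noetherian domain `O` with `(ϖ)` maximal there is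
a prime `Q ∋ ϖ, g₃` of `A′ = O[T₁,T₂]` at which `A′_Q/(g₃)` is not a regular local ring
(`g₃ ∈ Q²`, a non-zero-divisor in `𝔪_Q²`; Matsumura 14.2). [OURS · (E-β) negative row] -/
theorem cusp3_not_regular [IsDomain O] [IsNoetherianRing O] {ϖ : O} (hmax : (Ideal.span {ϖ}).IsMaximal)
    (u : O) :
    ∃ Q : Ideal (MvPolynomial (Fin 2) O), ∃ _ : Q.IsPrime, C ϖ ∈ Q ∧
      (X 1 ^ 2 + C ϖ * (C u - X 0 ^ 3) : MvPolynomial (Fin 2) O) ∈ Q ∧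
      ¬ IsRegularLocalRing (Localization.AtPrime Q ⧸
        Ideal.span {algebraMap (MvPolynomial (Fin 2) O) (Localization.AtPrime Q)
          (X 1 ^ 2 + C ϖ * (C u - X 0 ^ 3))}) := by
  obtain ⟨Q, hQ, hϖQ, -, hsq⟩ := cusp3_exists_prime_mem_sq hmax u
  haveI := hQ
  refine ⟨Q, hQ, hϖQ, Ideal.pow_le_self two_ne_zero hsq, ?_⟩
  apply not_isRegularLocalRing_quotient_span_singleton_of_mem_sq'
  · -- a non-zero-divisor: `A′_Q` is a domain and `g₃ ≠ 0`
    apply mem_nonZeroDivisors_of_ne_zero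
    intro h0
    have hinj := IsLocalization.injective (Localization.AtPrime Q) Q.primeCompl_le_nonZeroDivisors
    rw [← map_zero (algebraMap (MvPolynomial (Fin 2) O) (Localization.AtPrime Q))] at h0
    exact cusp3_ne_zero ϖ u (hinj h0)
  · rw [← Localization.AtPrime.map_eq_maximalIdeal, ← Ideal.map_pow]
    exact Ideal.mem_map_of_mem _ hsq

end Summit.ResolutionOfSingularities.ResolutionOfSingularities.Theorems.EquisingularLift.EBeta

end
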